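import Summits.CriticalPhenomena.PercolationContinuityZ3.Theses.PercBudgetLadder
import Literature.Probability.Percolation.MinOpenCut
import Literature.Barriers.CriticalPhenomena.SpanningClustersAboveSixProofs

/-!
# `BudgetTightness` (crux stmt-CriticalPhenomena-5248) — negative lemma: the aspect-2 form fails above six dimensions

Route `PercBudgetLadder`, crux r2 `BudgetTightness` (`d = 3`): `∃ k l c, 2 ≤ l ∧ 0 < c ∧ ∀ N ∃ n ≥ N,
c ≤ P_{p_c}(∃ S, #S ≤ k ∧ no open crossing B(n) → ∂ⁱⁿB(l n) inside B(l n) in ω \ S)`.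

NEGATIVE LEMMA (refuter, cdisprove; "any proof must use `d ≤ 6`"): the same statement with `3`
replaced by any `d > 6` satisfying Aizenman's two-point condition (t-c) with `η = 0`
(`TwoPointBoundedRatio d`; a theorem for `d ≥ 11` granted `Hara2008_etaZeroXSpace`) is FALSE at aspect
`l = 2`: `budgetTightness_aspect_two_false_above_six`. Mechanism: by the tree THEOREM
`SpanningClustersAboveSix_holds` (Aizenman 1997, Thm. 4 (3)) the number `N_n` of distinct clusters
spanning `Λ_n` satisfies `P_{p_c}(N_n ≥ k + 1) → 1`; `k + 1` distinct spanning clusters are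
vertex-disjoint, so closing any `k` edges leaves one of them intact
(`bulkSpanning_sdiff_of_numSpanning`); translated by `n e₁` and stopped at its first exit from `Λ_{2n}`
(`relabel_shift_mem_annulusCrossing` of the barrier file) it is an open crossing of the annulus
`Λ_n → ∂ⁱⁿΛ_{2n}` inside `Λ_{2n}` of `ω \ S`. Hence `P_{p_c}(blocked_k(n, 2n)) ≤ 1 - P(N_n ≥ k+1) → 0`
for every `k` (`real_blocked_two_le_one_sub`), contradicting `≥ c > 0` infinitely often.

This is the budget-`k` upgrade of `SpanningClustersAboveSix.not_annulusCrossing_bounded_away_from_one`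
(the `k = 0` case) and makes the barrier `SpanningClustersAboveSix` apply to the letter to r2 at aspect 2:
a `d`-uniform proof of the crux is impossible. (Aspects `l ≥ 4` would need Aizenman's count for slabs
of aspect `(l - 1)/2`, which is not vendored.)

References: M. Aizenman, Nuclear Phys. B 485 (1997) 551–582, Thm. 4 (3); G. Grimmett, Percolation
(1999), §13.1 (cutsets).
-/

noncomputable section

open MeasureTheory ProbabilityTheory Filter Topology
open scoped ENNReal
open Literature.Probability.Percolation Literature.Probability.LatticeModels
open Literature.Barriers.CriticalPhenomena (TwoPointBoundedRatio SpanningClustersAboveSix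
  SpanningClustersAboveSix_holds bulkSpanning numSpanningClusters leftFace rightFace annulusCrossing
  relabel_shift_mem_annulusCrossing)

namespace Summit.CriticalPhenomena.PercolationContinuityZ3.Theorems.BudgetTightness.Negative

/-- Walks inside an open cluster untouched by the closed set `S` survive the closing of `S`.
[folklore] -/
theorem reachable_sdiff_of_walk {V : Type*} {ω : BondConfig V} {S : Set (Sym2 V)}
    (C : (openGraph ω).ConnectedComponent)
    (hS : ∀ e ∈ S, (openGraph ω).connectedComponentMk e.out.1 ≠ C) :
    ∀ {u w : V} (_ : (openGraph ω).Walk u w), (openGraph ω).connectedComponentMk u = C →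
      (openGraph (ω \ S)).Reachable u w := by
  intro u w W
  induction W with
  | nil => intro; exact SimpleGraph.Reachable.refl _
  | @cons a b c hab W' ih =>
    intro haC
    have hbC : (openGraph ω).connectedComponentMk b = C := by
      rw [← haC]; exact (SimpleGraph.ConnectedComponent.connectedComponentMk_eq_of_adj hab).symm
    have hab' : (openGraph (ω \ S)).Adj a b := by
      rw [openGraph_adj] at hab ⊢
      refine ⟨⟨hab.1, fun hmem => ?_⟩, hab.2⟩
      have hout := Sym2.out_fst_mem (s(a, b))
      rw [Sym2.mem_iff] at hout
      rcases hout with h | h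
      · exact hS _ hmem (by rw [h]; exact haC)
      · exact hS _ hmem (by rw [h]; exact hbC)
    exact hab'.reachable.trans (ih hbC)

/-- **`k + 1` distinct spanning clusters survive the closing of any `k` edges**: each closed edge
touches at most one open cluster (pigeonhole on `e ↦ cluster of an endpoint of e`). [folklore] -/
theorem bulkSpanning_sdiff_of_numSpanning {d : ℕ} [NeZero d] {L k : ℕ} {ω : BondConfig (Site d)}
    (hN : ((k + 1 : ℕ) : ℕ∞) ≤ numSpanningClusters d L ω) {S : Finset (Sym2 (Site d))}
    (hS : S.card ≤ k) : ω \ ↑S ∈ bulkSpanning d L := by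
  classical
  set spanC : Set (openGraph ω).ConnectedComponent :=
    {C | (∃ x ∈ leftFace d L, x ∈ C.supp) ∧ ∃ y ∈ rightFace d L, y ∈ C.supp} with hspanC
  have hN' : ((k + 1 : ℕ) : ℕ∞) ≤ spanC.encard := hN
  set f : Sym2 (Site d) → (openGraph ω).ConnectedComponent :=
    fun e => (openGraph ω).connectedComponentMk e.out.1 with hf
  have himg : (f '' ↑S).encard ≤ k :=
    (Set.encard_image_le _ _).trans (by rw [Set.encard_coe_eq_coe_finsetCard]; exact_mod_cast hS)
  obtain ⟨C, hC, hCf⟩ : ∃ C ∈ spanC, C ∉ f '' ↑S := by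
    by_contra hcon
    push Not at hcon
    have h1 : spanC.encard ≤ k := (Set.encard_le_encard hcon).trans himg
    have h2 := hN'.trans h1
    norm_cast at h2
    omega
  obtain ⟨⟨x, hx, hxC⟩, y, hy, hyC⟩ := hC
  refine ⟨x, hx, y, hy, ?_⟩
  rw [SimpleGraph.ConnectedComponent.mem_supp_iff] at hxC hyC
  obtain ⟨W⟩ : (openGraph ω).Reachable x y := SimpleGraph.ConnectedComponent.exact (hxC.trans hyC.symm)
  have hS' : ∀ e ∈ (↑S : Set (Sym2 (Site d))), f e ≠ C := fun e he hfe => hCf ⟨e, he, hfe⟩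
  exact reachable_sdiff_of_walk C hS' W hxC

/-- The budget-`k` blocking event of the aspect-2 annulus is the complement of
"`ω \ S` crosses `Λ_n → ∂ⁱⁿΛ_{2n}` inside `Λ_{2n}` for every `#S ≤ k`"; it is measurable, being
`{minOpenCutIn ≤ k}` for the finite region `Λ_{2n}` (`MinOpenCut.lean`). [folklore] -/
theorem measurableSet_blockedTwo (d k n : ℕ) :
    MeasurableSet {ω : BondConfig (Site d) | ∃ S : Finset (Sym2 (Site d)), S.card ≤ k ∧
      ¬ ∃ x ∈ box d n, ∃ y ∈ innerBoundary (zdGraph d) (box d (2 * n)),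
        (ω \ ↑S) ∈ openConnIn (↑(box d (2 * n)) : Set (Site d)) x y} := by
  have hset : {ω : BondConfig (Site d) | ∃ S : Finset (Sym2 (Site d)), S.card ≤ k ∧
      ¬ ∃ x ∈ box d n, ∃ y ∈ innerBoundary (zdGraph d) (box d (2 * n)),
        (ω \ ↑S) ∈ openConnIn (↑(box d (2 * n)) : Set (Site d)) x y} =
      {ω | minOpenCutIn (↑(box d (2 * n)) : Set (Site d)) ↑(box d n)
        ↑(innerBoundary (zdGraph d) (box d (2 * n))) ω ≤ k} := by
    ext ω
    rw [Set.mem_setOf_eq, Set.mem_setOf_eq, minOpenCutIn_le_iff]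
    simp only [Finset.mem_coe]
  rw [hset]
  exact measurableSet_setOf_minOpenCutIn_le (Finset.finite_toSet _) _ _ k

/-- **Above six dimensions the aspect-2 budget events have small probability**:
`P_{p_c}(blocked_k(n, 2n)) ≤ 1 - P_{p_c}(N_n ≥ k + 1)` (translation by `n e₁`, first exit from `Λ_{2n}`,
and `bulkSpanning_sdiff_of_numSpanning`, on the almost sure event `ω ⊆ E(ℤ^d)`). [folklore] -/
theorem real_blockedTwo_le_one_sub {d : ℕ} [NeZero d] (k n : ℕ) :
    (bondPercolation (zdGraph d) (criticalProbI d)).real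
        {ω : BondConfig (Site d) | ∃ S : Finset (Sym2 (Site d)), S.card ≤ k ∧
          ¬ ∃ x ∈ box d n, ∃ y ∈ innerBoundary (zdGraph d) (box d (2 * n)),
            (ω \ ↑S) ∈ openConnIn (↑(box d (2 * n)) : Set (Site d)) x y} ≤
      1 - (bondPercolation (zdGraph d) (criticalProbI d)).real
        {ω | ENNReal.ofReal ((k : ℝ) + 1) ≤ (numSpanningClusters d n ω : ℝ≥0∞)} := by
  set μ := bondPercolation (zdGraph d) (criticalProbI d) with hμ
  set B : Set (BondConfig (Site d)) := {ω | ∃ S : Finset (Sym2 (Site d)), S.card ≤ k ∧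
      ¬ ∃ x ∈ box d n, ∃ y ∈ innerBoundary (zdGraph d) (box d (2 * n)),
        (ω \ ↑S) ∈ openConnIn (↑(box d (2 * n)) : Set (Site d)) x y} with hB
  set v : Site d := Pi.single 0 (n : ℤ) with hv
  set T := BondConfig.relabel (sym2Equiv (Site.shift v)) with hT
  -- pointwise: many spanning clusters ⇒ the shifted configuration is not blocked
  have hpt : ∀ ω : BondConfig (Site d), ω ⊆ (zdGraph d).edgeSet →
      ENNReal.ofReal ((k : ℝ) + 1) ≤ (numSpanningClusters d n ω : ℝ≥0∞) → T ω ∈ Bᶜ := by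
    intro ω hωE hNω
    have hN : ((k + 1 : ℕ) : ℕ∞) ≤ numSpanningClusters d n ω := by
      have e0 : ((k : ℝ) + 1) = ((k + 1 : ℕ) : ℝ) := by push_cast; ring
      have e1 : ENNReal.ofReal ((k : ℝ) + 1) = ((k + 1 : ℕ) : ℕ∞) := by
        rw [e0, ENNReal.ofReal_natCast]
        rfl
      rw [e1] at hNω
      exact ENat.toENNReal_le.1 hNω
    rintro ⟨S', hS'k, hS'⟩
    apply hS'
    set S : Finset (Sym2 (Site d)) := S'.map (sym2Equiv (Site.shift v)).symm.toEmbedding with hSdef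
    have hSk : S.card ≤ k := by rw [hSdef, Finset.card_map]; exact hS'k
    have hspan := bulkSpanning_sdiff_of_numSpanning hN hSk
    have hsub : ω \ ↑S ⊆ (zdGraph d).edgeSet := Set.sdiff_subset.trans hωE
    have hcross := relabel_shift_mem_annulusCrossing hsub hspan
    have hTS : BondConfig.relabel (sym2Equiv (Site.shift v)) (ω \ ↑S) = T ω \ ↑S' := by
      rw [hT, BondConfig.relabel_apply, BondConfig.relabel_apply,
        Set.image_sdiff (sym2Equiv (Site.shift v)).injective, hSdef, Finset.coe_map,
        Equiv.coe_toEmbedding, Equiv.image_symm_image]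
    rw [hTS] at hcross
    exact hcross
  have hae : ∀ᵐ ω ∂μ, ω ∈ {ω | ENNReal.ofReal ((k : ℝ) + 1) ≤ (numSpanningClusters d n ω : ℝ≥0∞)} →
      ω ∈ T ⁻¹' Bᶜ := by
    have hsub : ∀ᵐ ω ∂μ, ω ⊆ (zdGraph d).edgeSet := ProbabilityTheory.setBernoulli_ae_subset
    filter_upwards [hsub] with ω hω hN
    exact hpt ω hω hN
  have h1 : μ.real {ω | ENNReal.ofReal ((k : ℝ) + 1) ≤ (numSpanningClusters d n ω : ℝ≥0∞)} ≤
      μ.real (T ⁻¹' Bᶜ) :=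
    ENNReal.toReal_mono (measure_ne_top _ _) (measure_mono_ae hae)
  have h2 : μ.real (T ⁻¹' Bᶜ) = μ.real Bᶜ := bondPercolation_real_preimage_shift v _ _
  have h3 : μ.real Bᶜ = 1 - μ.real B := by
    rw [measureReal_compl (measurableSet_blockedTwo d k n), probReal_univ]
  linarith

/-- **NEGATIVE LEMMA for crux `BudgetTightness` — no `d`-uniform proof: the aspect-2 form is false in
every `d > 6` satisfying (t-c) with `η = 0`.** For such `d` there are no budget `k` and constant `c > 0`
with `P_{p_c(ℤ^d)}(blocked_k(n, 2n)) ≥ c` for infinitely many `n` (the crux's statement with `3 ↦ d`,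
`l ↦ 2`), because `P_{p_c}(N_n ≥ k + 1) → 1` (Aizenman 1997 Thm. 4 (3), tree theorem
`SpanningClustersAboveSix_holds`) and `real_blockedTwo_le_one_sub`. So any proof of r2 at aspect 2
must use a property of `ℤ³` that fails above six dimensions (barrier `SpanningClustersAboveSix`
applies to the letter). [cite: Aizenman1997, Thm. 4 (3)] -/
theorem budgetTightness_aspect_two_false_above_six {d : ℕ} [NeZero d] (hd : 6 < d)
    (hτ : TwoPointBoundedRatio d) :
    ¬ ∃ (k : ℕ) (c : ℝ), 0 < c ∧ ∀ N : ℕ, ∃ n : ℕ, N ≤ n ∧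
      c ≤ (bondPercolation (zdGraph d) (criticalProbI d)).real
        {ω : BondConfig (Site d) | ∃ S : Finset (Sym2 (Site d)), S.card ≤ k ∧
          ¬ ∃ x ∈ box d n, ∃ y ∈ innerBoundary (zdGraph d) (box d (2 * n)),
            (ω \ ↑S) ∈ openConnIn (↑(box d (2 * n)) : Set (Site d)) x y} := by
  rintro ⟨k, c, hc, h⟩
  have hT := SpanningClustersAboveSix_holds.numSpanning_ge_tendsto_one hd hτ ((k : ℝ) + 1)
  have hev := hT.eventually (lt_mem_nhds (show (1 : ℝ) - c < 1 by linarith))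
  obtain ⟨N, hN⟩ := Filter.eventually_atTop.1 hev
  obtain ⟨n, hn, hcn⟩ := h N
  have := real_blockedTwo_le_one_sub (d := d) k n
  linarith [hN n hn]

/-- Packaged against the crux's quantifier shape (`∃ k l c, 2 ≤ l ∧ …` restricted to `l = 2`): in
`d = 7` (granted (t-c)) the aspect-2 witness is unavailable. [cite: Aizenman1997, Thm. 4 (3)] -/
theorem budgetTightness_dim_seven_aspect_two_false (hτ : TwoPointBoundedRatio 7) :
    ¬ ∃ (k l : ℕ) (c : ℝ), l = 2 ∧ 0 < c ∧ ∀ N : ℕ, ∃ n : ℕ, N ≤ n ∧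
      c ≤ (bondPercolation (zdGraph 7) (criticalProbI 7)).real
        {ω : BondConfig (Site 7) | ∃ S : Finset (Sym2 (Site 7)), S.card ≤ k ∧
          ¬ ∃ x ∈ box 7 n, ∃ y ∈ innerBoundary (zdGraph 7) (box 7 (l * n)),
            (ω \ ↑S) ∈ openConnIn (↑(box 7 (l * n)) : Set (Site 7)) x y} := by
  rintro ⟨k, l, c, rfl, hc, h⟩
  exact budgetTightness_aspect_two_false_above_six (d := 7) (by norm_num) hτ ⟨k, c, hc, h⟩

end Summit.CriticalPhenomena.PercolationContinuityZ3.Theorems.BudgetTightness.Negative
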